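import Literature.NumberTheory.LFunctions.ConreyGhoshKernels
import HarnessLib

/-!
# The Conrey–Ghosh transform (Booker 2003, Lemma 2), II: resummation — Lemma 2 for an arbitrary
# absolutely convergent Dirichlet series

Topic `Literature/NumberTheory/LFunctions`; continues `ConreyGhoshKernels.lean` (see there for
the statement of Booker's Lemma 2 and its printed proof). Everything here is PROVED; no named
facts, no definitions.

* `integral_LSeries_mul_eq_tsum` — term-by-term integration of `L(a, σ+iy) E(y)` along a
  vertical line when `∑ ‖a(n)‖ n^{-σ} < ∞` and `E ∈ L¹(ℝ)`;
* `integrable_of_norm_le_exp_mul_Gamma` — `‖g(y)‖ ≤ C e^{b|y|} ‖Γ(σ'+iy)‖` with `b < π/2`,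
  `σ' > 0` ⟹ `g ∈ L¹` (the tree's polynomial-times-`e^{-π|y|/2}` bound for `Γ` on vertical lines,
  `Literature.Analysis.Complex.exists_norm_Gamma_vertical_le`);
* `integrable_lhs_kernel`, `integrable_rhs_kernel` — the two kernels of (9) are integrable
  (`|ν(π/2-δ)| < π/2`, resp. `δ/2 < π/2`);
* `booker_lemma2` — **Booker's Lemma 2** (9) for every Dirichlet series `∑ a(n) n^{-s}` absolutely
  convergent on the line `re s = σ`, every `c` with `σ + c > 0`, `α > 0`, `ν = ±1`,
  `0 < δ < π/2`; the additive twist is `n ↦ a(n) e(-nνα)`, `e(x) = e^{2πix}`. (Printed for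
  `L(s, ρ)`; the proof uses only absolute convergence on the line of integration.)

## References

* A. R. Booker, *Poles of Artin L-functions and the strong Artin conjecture*, Ann. of Math. (2)
  158 (2003), 1089–1098: Lemma 2, pp. 1093–1094. [Booker2003]
-/

noncomputable section

open _root_.Complex Set MeasureTheory Filter Real
open scoped _root_.Topology

namespace Literature.NumberTheory.LFunctions

namespace ConreyGhosh

open Literature.Analysis.Complex Literature.Analysis.SpecialFunctions

/-! ### Interchanging the Dirichlet series with the line integral -/

/-- The terms `y ↦ a(n) n^{-(σ+iy)}` are continuous. [folklore] -/
theorem continuous_term (a : ℕ → ℂ) (σ : ℝ) (n : ℕ) :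
    Continuous fun y : ℝ ↦ LSeries.term a (σ + y * I) n := by
  rcases eq_or_ne n 0 with rfl | hn
  · simp only [LSeries.term_zero]
    exact continuous_const
  · simp only [LSeries.term_of_ne_zero hn, div_eq_mul_inv, ← Complex.cpow_neg]
    refine continuous_const.mul (continuous_iff_continuousAt.2 fun y ↦ ?_)
    exact (continuousAt_const_cpow (Nat.cast_ne_zero.2 hn)).comp (by fun_prop)

/-- `‖a(n) n^{-(σ+iy)}‖ = ‖a(n) n^{-σ}‖`. [folklore] -/
theorem norm_term_vertical (a : ℕ → ℂ) (σ y : ℝ) (n : ℕ) :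
    ‖LSeries.term a (σ + y * I) n‖ = ‖LSeries.term a σ n‖ := by
  rw [LSeries.norm_term_eq, LSeries.norm_term_eq]
  simp

/-- **Term-by-term integration of a Dirichlet series along a vertical line.** If
`∑ ‖a(n)‖ n^{-σ} < ∞` and `E` is integrable on `ℝ`, then
`∫ L(a, σ+iy) E(y) dy = ∑_n ∫ a(n) n^{-(σ+iy)} E(y) dy` (dominated convergence /
`integral_tsum_of_summable_integral_norm`). [folklore] -/
theorem integral_LSeries_mul_eq_tsum {a : ℕ → ℂ} {σ : ℝ}
    (hsum : Summable fun n ↦ ‖LSeries.term a σ n‖) {E : ℝ → ℂ} (hE : Integrable E) :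
    ∫ y : ℝ, LSeries a (σ + y * I) * E y =
      ∑' n : ℕ, ∫ y : ℝ, LSeries.term a (σ + y * I) n * E y := by
  have hF : ∀ n, Integrable fun y : ℝ ↦ LSeries.term a (σ + y * I) n * E y := by
    intro n
    refine Integrable.mono' (hE.norm.const_mul ‖LSeries.term a σ n‖)
      (((continuous_term a σ n).aestronglyMeasurable).mul hE.aestronglyMeasurable)
      (Eventually.of_forall fun y ↦ ?_)
    rw [norm_mul, norm_term_vertical]
  have hS : Summable fun n ↦ ∫ y : ℝ, ‖LSeries.term a (σ + y * I) n * E y‖ := by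
    have h : ∀ n, (∫ y : ℝ, ‖LSeries.term a (σ + y * I) n * E y‖) =
        ‖LSeries.term a σ n‖ * ∫ y : ℝ, ‖E y‖ := by
      intro n
      rw [← integral_const_mul]
      refine integral_congr_ae (Eventually.of_forall fun y ↦ ?_)
      simp only [norm_mul, norm_term_vertical]
    simp_rw [h]
    exact hsum.mul_right _
  rw [integral_tsum_of_summable_integral_norm hF hS]
  refine integral_congr_ae (Eventually.of_forall fun y ↦ ?_)
  simp only [LSeries, tsum_mul_right]

/-- **Integrability against `Γ` on a vertical line.** A continuous `g : ℝ → ℂ` with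
`‖g(y)‖ ≤ C e^{b|y|} ‖Γ(σ' + iy)‖`, `σ' > 0`, `b < π/2`, is integrable on `ℝ`
(`‖Γ(σ' + iy)‖ ≤ K (1+|y|)^N e^{-π|y|/2}`). [folklore] -/
theorem integrable_of_norm_le_exp_mul_Gamma {g : ℝ → ℂ} (hg : Continuous g) {C b σ' : ℝ}
    (hσ' : 0 < σ') (hb : b < π / 2)
    (hle : ∀ y : ℝ, ‖g y‖ ≤ C * Real.exp (b * |y|) * ‖Complex.Gamma (σ' + y * I)‖) :
    Integrable g := by
  obtain ⟨K, N, hK, hN, hΓ⟩ := exists_norm_Gamma_vertical_le hσ'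
  have ha : 0 < π / 2 - b := by linarith
  refine Integrable.mono'
    ((integrable_one_add_abs_rpow_mul_exp_neg ha hN).const_mul (max C 0 * K))
    hg.aestronglyMeasurable (Eventually.of_forall fun y ↦ ?_)
  have h1 := hle y
  have hexp : Real.exp (b * |y|) * Real.exp (-(π / 2 * |y|)) = Real.exp (-((π / 2 - b) * |y|)) := by
    rw [← Real.exp_add]; congr 1; ring
  calc ‖g y‖ ≤ C * Real.exp (b * |y|) * ‖Complex.Gamma (σ' + y * I)‖ := h1
    _ ≤ max C 0 * Real.exp (b * |y|) * ‖Complex.Gamma (σ' + y * I)‖ := by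
        gcongr; exact le_max_left _ _
    _ ≤ max C 0 * Real.exp (b * |y|) * (K * (1 + |y|) ^ N * Real.exp (-(π / 2 * |y|))) := by
        gcongr
        exact hΓ y
    _ = max C 0 * K * ((1 + |y|) ^ N * Real.exp (-((π / 2 - b) * |y|))) := by
        rw [← hexp]; ring

/-! ### Integrability of the two kernels of (9) -/

/-- The left kernel `E_L(y) = (α e^{iθ})^{1/2-s} (2π)^{-s} Γ(s+c)`, `s = σ + iy`, is integrable for
`σ + c > 0`, `α > 0`, `|θ| < π/2`: `‖E_L(y)‖ = α^{1/2-σ} e^{θy} (2π)^{-σ} ‖Γ(σ+c+iy)‖`.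
[cite: Booker2003, Lemma 2 (p. 1093)] -/
theorem integrable_lhs_kernel {σ c α θ : ℝ} (hσc : 0 < σ + c) (hα : 0 < α) (hθ : |θ| < π / 2) :
    Integrable fun y : ℝ ↦ ((α : ℂ) * cexp (θ * I)) ^ (1 / 2 - ((σ : ℂ) + y * I)) *
      (((2 * π : ℝ) : ℂ)) ^ (-((σ : ℂ) + y * I)) * Complex.Gamma (σ + c + y * I) := by
  have hπ := Real.pi_pos
  have h2π : (0 : ℝ) < 2 * π := by positivity
  have hθ₁ : -π < θ := by linarith [(abs_lt.1 hθ).1]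
  have hθ₂ : θ ≤ π := by linarith [(abs_lt.1 hθ).2]
  have hbase : (α : ℂ) * cexp (θ * I) ≠ 0 :=
    mul_ne_zero (ofReal_ne_zero.2 hα.ne') (Complex.exp_ne_zero _)
  refine integrable_of_norm_le_exp_mul_Gamma (σ' := σ + c) (b := |θ|)
    (C := Real.exp ((1 / 2 - σ) * Real.log α) * Real.exp (-σ * Real.log (2 * π))) ?_ hσc hθ ?_
  · refine ((continuous_iff_continuousAt.2 fun y ↦ ?_).mul
      (continuous_iff_continuousAt.2 fun y ↦ ?_)).mul ?_
    · exact (continuousAt_const_cpow hbase).comp (by fun_prop)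
    · exact (continuousAt_const_cpow (ofReal_ne_zero.2 h2π.ne')).comp (by fun_prop)
    · have h : Continuous fun y : ℝ ↦ Complex.Gamma (((σ + c : ℝ) : ℂ) + y * I) := by
        simpa using continuous_Gamma_mul_cpow_neg hσc one_ne_zero
      refine h.congr fun y ↦ ?_
      push_cast; ring_nf
  · intro y
    rw [norm_mul, norm_mul, ofReal_mul_exp_cpow hα hθ₁ hθ₂, ofReal_cpow_eq_exp h2π,
      Complex.norm_exp, Complex.norm_exp]
    have hre1 : ((1 / 2 - ((σ : ℂ) + y * I)) * (Real.log α + θ * I)).re =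
        (1 / 2 - σ) * Real.log α + θ * y := by
      simp only [sub_re, mul_re, add_re, ofReal_re, mul_im, add_im, ofReal_im, I_re, I_im,
        sub_im, one_div]
      simp
      ring
    have hre2 : (-((σ : ℂ) + y * I) * (Real.log (2 * π) : ℂ)).re = -σ * Real.log (2 * π) := by
      simp
    rw [hre1, hre2, Real.exp_add]
    have hθy : Real.exp (θ * y) ≤ Real.exp (|θ| * |y|) := by
      rw [Real.exp_le_exp, ← abs_mul]; exact le_abs_self _
    have hΓ : ‖Complex.Gamma (σ + c + y * I)‖ = ‖Complex.Gamma (((σ + c : ℝ) : ℂ) + y * I)‖ := by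
      push_cast; ring_nf
    rw [hΓ]
    calc Real.exp ((1 / 2 - σ) * Real.log α) * Real.exp (θ * y) * Real.exp (-σ * Real.log (2 * π)) *
          ‖Complex.Gamma (((σ + c : ℝ) : ℂ) + y * I)‖
        ≤ Real.exp ((1 / 2 - σ) * Real.log α) * Real.exp (|θ| * |y|) *
            Real.exp (-σ * Real.log (2 * π)) * ‖Complex.Gamma (((σ + c : ℝ) : ℂ) + y * I)‖ := by
          gcongr
      _ = Real.exp ((1 / 2 - σ) * Real.log α) * Real.exp (-σ * Real.log (2 * π)) *
            Real.exp (|θ| * |y|) * ‖Complex.Gamma (((σ + c : ℝ) : ℂ) + y * I)‖ := by ring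

/-- The right kernel `E_R(y) = α^{1/2-s} e^{iν[(δ/2)(s-c-1)+(π/2)(c+1/2)]} (2 sin(δ/2))^{-(s+c)}
(2π)^{-s} Γ(s+c)`, `s = σ + iy`, is integrable for `σ + c > 0`, `α > 0`, `0 < δ < π/2`, `ν = ±1`:
`‖E_R(y)‖ = α^{1/2-σ} e^{-νδy/2} (2 sin(δ/2))^{-(σ+c)} (2π)^{-σ} ‖Γ(σ+c+iy)‖`.
[cite: Booker2003, Lemma 2 (p. 1093)] -/
theorem integrable_rhs_kernel {σ c α δ ν : ℝ} (hσc : 0 < σ + c) (hα : 0 < α) (hδ : 0 < δ)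
    (hδ' : δ < π / 2) (hν : ν = 1 ∨ ν = -1) :
    Integrable fun y : ℝ ↦ (α : ℂ) ^ (1 / 2 - ((σ : ℂ) + y * I)) *
      cexp (I * ν * (δ / 2 * (((σ : ℂ) + y * I) - c - 1) + π / 2 * (c + 1 / 2))) *
      (((2 * Real.sin (δ / 2) : ℝ) : ℂ)) ^ (-(((σ : ℂ) + y * I) + c)) *
      (((2 * π : ℝ) : ℂ)) ^ (-((σ : ℂ) + y * I)) * Complex.Gamma (σ + c + y * I) := by
  have hπ := Real.pi_pos
  have h2π : (0 : ℝ) < 2 * π := by positivity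
  have hsin : 0 < 2 * Real.sin (δ / 2) := by
    have := Real.sin_pos_of_pos_of_lt_pi (by positivity : 0 < δ / 2) (by linarith)
    positivity
  have hν1 : |ν| = 1 := by rcases hν with rfl | rfl <;> simp
  refine integrable_of_norm_le_exp_mul_Gamma (σ' := σ + c) (b := δ / 2)
    (C := Real.exp ((1 / 2 - σ) * Real.log α) * Real.exp (-(σ + c) * Real.log (2 * Real.sin (δ / 2))) *
      Real.exp (-σ * Real.log (2 * π))) ?_ hσc (by linarith) ?_
  · refine ((((continuous_iff_continuousAt.2 fun y ↦ ?_).mul (by fun_prop)).mul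
      (continuous_iff_continuousAt.2 fun y ↦ ?_)).mul
      (continuous_iff_continuousAt.2 fun y ↦ ?_)).mul ?_
    · exact (continuousAt_const_cpow (ofReal_ne_zero.2 hα.ne')).comp (by fun_prop)
    · exact (continuousAt_const_cpow (ofReal_ne_zero.2 hsin.ne')).comp (by fun_prop)
    · exact (continuousAt_const_cpow (ofReal_ne_zero.2 h2π.ne')).comp (by fun_prop)
    · have h : Continuous fun y : ℝ ↦ Complex.Gamma (((σ + c : ℝ) : ℂ) + y * I) := by
        simpa using continuous_Gamma_mul_cpow_neg hσc one_ne_zero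
      refine h.congr fun y ↦ ?_
      push_cast; ring_nf
  · intro y
    rw [norm_mul, norm_mul, norm_mul, norm_mul, ofReal_cpow_eq_exp hα, ofReal_cpow_eq_exp hsin,
      ofReal_cpow_eq_exp h2π, Complex.norm_exp, Complex.norm_exp, Complex.norm_exp,
      Complex.norm_exp]
    have hre1 : ((1 / 2 - ((σ : ℂ) + y * I)) * (Real.log α : ℂ)).re = (1 / 2 - σ) * Real.log α := by
      simp
    have hre2 : (I * ν * (δ / 2 * (((σ : ℂ) + y * I) - c - 1) + π / 2 * (c + 1 / 2))).re =
        -(ν * (δ / 2) * y) := by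
      simp only [mul_re, mul_im, add_re, add_im, sub_re, sub_im, I_re, I_im, ofReal_re,
        ofReal_im]
      simp
      ring
    have hre3 : (-(((σ : ℂ) + y * I) + c) * (Real.log (2 * Real.sin (δ / 2)) : ℂ)).re =
        -(σ + c) * Real.log (2 * Real.sin (δ / 2)) := by
      simp
    have hre4 : (-((σ : ℂ) + y * I) * (Real.log (2 * π) : ℂ)).re = -σ * Real.log (2 * π) := by
      simp
    rw [hre1, hre2, hre3, hre4]
    have hy : Real.exp (-(ν * (δ / 2) * y)) ≤ Real.exp (δ / 2 * |y|) := by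
      rw [Real.exp_le_exp]
      calc -(ν * (δ / 2) * y) ≤ |-(ν * (δ / 2) * y)| := le_abs_self _
        _ = δ / 2 * |y| := by
            rw [abs_neg, abs_mul, abs_mul, hν1, one_mul, abs_of_pos (by positivity : 0 < δ / 2)]
    have hΓ : ‖Complex.Gamma (σ + c + y * I)‖ = ‖Complex.Gamma (((σ + c : ℝ) : ℂ) + y * I)‖ := by
      push_cast; ring_nf
    rw [hΓ]
    calc Real.exp ((1 / 2 - σ) * Real.log α) * Real.exp (-(ν * (δ / 2) * y)) *
          Real.exp (-(σ + c) * Real.log (2 * Real.sin (δ / 2))) * Real.exp (-σ * Real.log (2 * π)) *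
          ‖Complex.Gamma (((σ + c : ℝ) : ℂ) + y * I)‖
        ≤ Real.exp ((1 / 2 - σ) * Real.log α) * Real.exp (δ / 2 * |y|) *
          Real.exp (-(σ + c) * Real.log (2 * Real.sin (δ / 2))) * Real.exp (-σ * Real.log (2 * π)) *
          ‖Complex.Gamma (((σ + c : ℝ) : ℂ) + y * I)‖ := by gcongr
      _ = _ := by ring

/-! ### Booker's Lemma 2 -/

/-- **Booker 2003, Lemma 2 (the Conrey–Ghosh transform), for an arbitrary Dirichlet series.**
Let `L(s) = ∑ a(n) n^{-s}` converge absolutely on `re s = σ`, let `α > 0`, `ν = ±1`,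
`0 < δ < π/2`, and `σ + c > 0`. With `s = σ + iy` and the additive twist
`L(s, να) = ∑ a(n) e(-nνα) n^{-s}` (`e(x) = e^{2πix}`), Booker's (9) holds:
`∫ L(s) (α e^{iν(π/2-δ)})^{1/2-s} (2π)^{-s} Γ(s+c) dy
 = ∫ L(s, να) α^{1/2-s} e^{iν[(δ/2)(s-c-1) + (π/2)(c+1/2)]} (2 sin(δ/2))^{-(s+c)} (2π)^{-s} Γ(s+c) dy`
(both sides `i ·` the printed `(1/2πi)∫ … ds` up to the common factor `1/2π`). Printed for
`L(s) = L(s, ρ)` an Artin `L`-function on a line "far to the right"; the proof ((10)–(11):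
`F(z) = z^c e^{-z}` as a Mellin integral, termwise, and resummation) uses only absolute
convergence, which is the hypothesis here. [cite: Booker2003, Lemma 2 (pp. 1093–1094)] -/
theorem booker_lemma2 {a : ℕ → ℂ} {σ c α δ ν : ℝ}
    (hsum : Summable fun n ↦ ‖LSeries.term a σ n‖) (hσc : 0 < σ + c) (hα : 0 < α)
    (hδ : 0 < δ) (hδ' : δ < π / 2) (hν : ν = 1 ∨ ν = -1) :
    ∫ y : ℝ, LSeries a (σ + y * I) *
        (((α : ℂ) * cexp (((ν * (π / 2 - δ) : ℝ) : ℂ) * I)) ^ (1 / 2 - ((σ : ℂ) + y * I)) *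
          (((2 * π : ℝ) : ℂ)) ^ (-((σ : ℂ) + y * I)) * Complex.Gamma (σ + c + y * I)) =
      ∫ y : ℝ, LSeries (fun n ↦ a n * cexp (-(2 * π * I * ν * α * n))) (σ + y * I) *
        ((α : ℂ) ^ (1 / 2 - ((σ : ℂ) + y * I)) *
          cexp (I * ν * (δ / 2 * (((σ : ℂ) + y * I) - c - 1) + π / 2 * (c + 1 / 2))) *
          (((2 * Real.sin (δ / 2) : ℝ) : ℂ)) ^ (-(((σ : ℂ) + y * I) + c)) *
          (((2 * π : ℝ) : ℂ)) ^ (-((σ : ℂ) + y * I)) * Complex.Gamma (σ + c + y * I)) := by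
  have hν1 : |ν| = 1 := by rcases hν with rfl | rfl <;> simp
  have hθ : |ν * (π / 2 - δ)| < π / 2 := by
    rw [abs_mul, hν1, one_mul, abs_lt]; constructor <;> linarith
  set b : ℕ → ℂ := fun n ↦ a n * cexp (-(2 * π * I * ν * α * n)) with hb
  have hsum' : Summable fun n ↦ ‖LSeries.term b σ n‖ := by
    refine hsum.congr fun n ↦ ?_
    rw [LSeries.norm_term_eq, LSeries.norm_term_eq]
    rcases eq_or_ne n 0 with rfl | hn
    · simp
    · simp only [hn, if_false, hb, norm_mul]
      rw [show -(2 * π * I * ν * α * n) = ((-(2 * π * ν * α * n) : ℝ) : ℂ) * I by push_cast; ring,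
        Complex.norm_exp_ofReal_mul_I, mul_one]
  rw [integral_LSeries_mul_eq_tsum hsum (integrable_lhs_kernel hσc hα hθ),
    integral_LSeries_mul_eq_tsum hsum' (integrable_rhs_kernel hσc hα hδ hδ' hν)]
  refine tsum_congr fun n ↦ ?_
  rcases eq_or_ne n 0 with rfl | hn
  · simp [LSeries.term_zero]
  have hn0 : 0 < n := Nat.pos_of_ne_zero hn
  have hL : ∀ y : ℝ, LSeries.term a (σ + y * I) n *
        (((α : ℂ) * cexp (((ν * (π / 2 - δ) : ℝ) : ℂ) * I)) ^ (1 / 2 - ((σ : ℂ) + y * I)) *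
          (((2 * π : ℝ) : ℂ)) ^ (-((σ : ℂ) + y * I)) * Complex.Gamma (σ + c + y * I)) =
      a n * ((n : ℂ) ^ (-((σ : ℂ) + y * I)) *
        ((α : ℂ) * cexp (((ν * (π / 2 - δ) : ℝ) : ℂ) * I)) ^ (1 / 2 - ((σ : ℂ) + y * I)) *
        (((2 * π : ℝ) : ℂ)) ^ (-((σ : ℂ) + y * I)) * Complex.Gamma (σ + c + y * I)) := by
    intro y
    rw [LSeries.term_of_ne_zero hn, div_eq_mul_inv, ← Complex.cpow_neg]
    ring
  have hR : ∀ y : ℝ, LSeries.term b (σ + y * I) n *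
        ((α : ℂ) ^ (1 / 2 - ((σ : ℂ) + y * I)) *
          cexp (I * ν * (δ / 2 * (((σ : ℂ) + y * I) - c - 1) + π / 2 * (c + 1 / 2))) *
          (((2 * Real.sin (δ / 2) : ℝ) : ℂ)) ^ (-(((σ : ℂ) + y * I) + c)) *
          (((2 * π : ℝ) : ℂ)) ^ (-((σ : ℂ) + y * I)) * Complex.Gamma (σ + c + y * I)) =
      (a n * cexp (-(2 * π * I * ν * α * n))) * ((n : ℂ) ^ (-((σ : ℂ) + y * I)) *
        (α : ℂ) ^ (1 / 2 - ((σ : ℂ) + y * I)) *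
        cexp (I * ν * (δ / 2 * (((σ : ℂ) + y * I) - c - 1) + π / 2 * (c + 1 / 2))) *
        (((2 * Real.sin (δ / 2) : ℝ) : ℂ)) ^ (-(((σ : ℂ) + y * I) + c)) *
        (((2 * π : ℝ) : ℂ)) ^ (-((σ : ℂ) + y * I)) * Complex.Gamma (σ + c + y * I)) := by
    intro y
    rw [LSeries.term_of_ne_zero hn, hb, div_eq_mul_inv, ← Complex.cpow_neg]
    ring
  rw [integral_congr_ae (Eventually.of_forall hL), integral_congr_ae (Eventually.of_forall hR),
    integral_const_mul, integral_const_mul, integral_lhs_kernel hσc hα hθ hn0,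
    integral_rhs_kernel hσc hα hδ hδ' hν hn0, lhs_term_eq_rhs_term hα hδ hδ' hν c hn0]
  ring

end ConreyGhosh

end Literature.NumberTheory.LFunctions
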